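import Literature.NumberTheory.EllipticCurves.EisensteinDedekindMeasureTwo
import Summits.BirchSwinnertonDyer.BirchSwinnertonDyer.Theorems.EisensteinDepletionAtTwoStarStabCoeffBoundary
import Summits.BirchSwinnertonDyer.BirchSwinnertonDyer.Theorems.EisensteinDepletionAtTwoStarCuspValues
import HarnessLib

/-!
# Route `EisensteinDepletionAtTwo`, crux E1M `DepletedLambdaLawAtTwoMod` (item stmt-BirchSwinnertonDyer-20341),
# line `star`, Eisenstein half — §D: the Stevens smoothing of the `C`-normalised Eisenstein measure, POINTWISE:
# `‖(Sm_5^5 ν₈)(a) + (3/2)·(Sm_5^5 E_{N.divisors,c})(a)‖₂ ≤ 2⁻¹` on every `η = +1` class of level `≥ 4`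

Cell `bsd-rank2`, seat `bsd-rank2-eng-2` GEN 8. THEOREMS ONLY — no definition, no named fact, no `sorry`. HONEST FRAMING: `2`-adic
bookkeeping; the key pointwise estimate of the finite-level form (★-EisFin) of the Eisenstein half of (★) (evidence #39 on the item):
in the `8`-normalisation (`ν₈ = eisNormMeasure N β 8`, the `2`-content of `stabEisCuspDiff` on `C` is exactly `2³` numerically) the
Stevens smoothing `Sm_5^5` (lit's `stevensSmoothing 5`) of the `C`-normalised Eisenstein measure is `−(3/2) × Sm_5^5` of lit's
Eisenstein–Dedekind distribution `eisensteinDedekindTwo N.divisors (stabCoeff N β)` modulo `2ℤ₂`, because (i) pointwise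
`8ν₈ = [−12E + c_βB](X) − [level constant]` (`stabEisensteinPeriod_sub_level`), (ii) `Sm` of a level constant is `16×` a `2`-adic
integer, (iii) `Sm` of the Bézout boundary term `B` is an INTEGER for any Bézout representatives (`exists_int_smoothed_boundary`:
`N y_X − 5 N y_{5X} ≡ X⁻¹ − X⁻¹ (mod 2^m)`) and `‖c_β‖₂ ≤ 2⁻⁴` (`norm_cBeta_le`). Neither `E` nor `B` is `2`-integral pointwise;
only after smoothing does the boundary term die, with a margin of exactly one power of `2`. Nothing here reads an analytic rank;
(★)/E1M are NOT proved; BSD is not proved by any of this (PARTITION D-0054: none — r_an ≥ 2 axis S0, door T-r3₂).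

* `eisNormMeasure_eq_sub_sub`, `eisensteinDedekindTwo_apply_of_mod_four` (lit's `E` on an `η = +1` class = the Dedekind part),
  `stevensSmoothing_five_apply`, `stevensSmoothing_eisNormMeasure_of_not` (the smoothed measure vanishes off the `η = +1` classes of
  level `≥ 4`), `exists_int_smoothed_boundary`, **`norm_stevensSmoothing_eisNormMeasure_add_le`**.

References: G. Stevens, *Arithmetic on Modular Curves* (1982), §5.4 Prop. 5.4.1 [Stevens1982]; B. Mazur, J. Tate, J. Teitelbaum,
Invent. Math. 84 (1986), §I.10–I.11 [MazurTateTeitelbaum1986Invent].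
-/

set_option linter.dupNamespace false
set_option autoImplicit false

noncomputable section

open scoped Classical

namespace Summit.BirchSwinnertonDyer.BirchSwinnertonDyer.Theorems.DepletionAtTwo

open Literature.NumberTheory.ModularForms

section Smoothing

variable {N : ℕ} {β : ℕ → ℕ}

open Literature.NumberTheory.EllipticCurves Filter

/-- **The `C`-normalised measure on an `η = +1` class, as an `α = 1` combination of cusp values**: for `m ≥ 4` and
`x.val ≡ 1 (mod 4)`, `g·ν_g(x + 2^mℤ₂) = [φ_β(γ_{X,2^m}) − φ_β(γ_{X̄,2^{m−1}})] − [φ_β(γ_{1,2^m}) − φ_β(γ_{1,2^{m−1}})]`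
(`X = x.val`, `X̄ = X mod 2^{m−1}`; the second bracket is the LEVEL CONSTANT). [cite: MazurTateTeitelbaum1986Invent, §I.10 (10.1)] -/
theorem eisNormMeasure_eq_sub_sub (g : ℚ) {m : ℕ} (hm : 4 ≤ m) (x : ZMod (2 ^ m)) (hx : x.val % 4 = 1) :
    eisNormMeasure N β g m x =
      ((((stabEisensteinPeriod N β (gammaEntries N x.val ((2 ^ m : ℕ) : ℤ)).1 (gammaEntries N x.val ((2 ^ m : ℕ) : ℤ)).2.1
            (gammaEntries N x.val ((2 ^ m : ℕ) : ℤ)).2.2.1 (gammaEntries N x.val ((2 ^ m : ℕ) : ℤ)).2.2.2 -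
          stabEisensteinPeriod N β (gammaEntries N ((x.val % 2 ^ (m - 1) : ℕ) : ℤ) ((2 ^ (m - 1) : ℕ) : ℤ)).1
            (gammaEntries N ((x.val % 2 ^ (m - 1) : ℕ) : ℤ) ((2 ^ (m - 1) : ℕ) : ℤ)).2.1
            (gammaEntries N ((x.val % 2 ^ (m - 1) : ℕ) : ℤ) ((2 ^ (m - 1) : ℕ) : ℤ)).2.2.1
            (gammaEntries N ((x.val % 2 ^ (m - 1) : ℕ) : ℤ) ((2 ^ (m - 1) : ℕ) : ℤ)).2.2.2) -
        (stabEisensteinPeriod N β (gammaEntries N ((1 : ℕ) : ℤ) ((2 ^ m : ℕ) : ℤ)).1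
            (gammaEntries N ((1 : ℕ) : ℤ) ((2 ^ m : ℕ) : ℤ)).2.1
            (gammaEntries N ((1 : ℕ) : ℤ) ((2 ^ m : ℕ) : ℤ)).2.2.1 (gammaEntries N ((1 : ℕ) : ℤ) ((2 ^ m : ℕ) : ℤ)).2.2.2 -
          stabEisensteinPeriod N β (gammaEntries N ((1 % 2 ^ (m - 1) : ℕ) : ℤ) ((2 ^ (m - 1) : ℕ) : ℤ)).1
            (gammaEntries N ((1 % 2 ^ (m - 1) : ℕ) : ℤ) ((2 ^ (m - 1) : ℕ) : ℤ)).2.1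
            (gammaEntries N ((1 % 2 ^ (m - 1) : ℕ) : ℤ) ((2 ^ (m - 1) : ℕ) : ℤ)).2.2.1
            (gammaEntries N ((1 % 2 ^ (m - 1) : ℕ) : ℤ) ((2 ^ (m - 1) : ℕ) : ℤ)).2.2.2)) / g : ℚ) : ℚ_[2]) := by
  have h1 : (1 : ℕ) % 2 ^ (m - 1) = 1 := Nat.one_mod_eq_one.mpr (by
    have : 2 ≤ 2 ^ (m - 1) := by
      calc (2 : ℕ) = 2 ^ 1 := by norm_num
        _ ≤ 2 ^ (m - 1) := Nat.pow_le_pow_right (by norm_num) (by omega)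
    omega)
  rw [eisNormMeasure_of N β g ⟨hm, hx⟩, h1]
  unfold stabEisCuspDiff
  simp only [Nat.cast_one]
  congr 2
  ring

/-- **Lit's Eisenstein–Dedekind distribution on an `η = +1` class is the Dedekind part of the cusp values**:
for `m ≥ 2` and `x.val ≡ 1 (mod 4)` (`χ₋₄(x) = 1`),
`E_{N.divisors, c}(x + 2^mℤ₂) = ∑_t c_t (s(t·x, 2^m) − s(t·x, 2^{m−1}))`. [cite: Stevens1982, §2.5 and §5.4 (PDF pp. 38, 72–73)] -/
theorem eisensteinDedekindTwo_apply_of_mod_four (hodd : Odd N) {m : ℕ} (hm : 2 ≤ m) (x : ZMod (2 ^ m))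
    (hx : x.val % 4 = 1) :
    eisensteinDedekindTwo N.divisors (stabCoeff N β) m x =
      ((∑ t ∈ N.divisors, stabCoeff N β t *
          (dedekindSum (t * x.val : ℤ) (2 ^ m) - dedekindSum (t * x.val : ℤ) (2 ^ (m - 1))) : ℚ) : ℚ_[2]) := by
  have hT : ∀ t ∈ N.divisors, Odd t := fun t ht ↦ hodd.of_dvd_nat (Nat.dvd_of_mem_divisors ht)
  have hoddx : Odd x.val := odd_val_of_mod_four x hx
  have hcop : Nat.Coprime x.val (2 ^ m) := Nat.Coprime.pow_right m (Nat.coprime_two_right.mpr hoddx)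
  set u := ZMod.unitOfCoprime x.val hcop with hu_def
  have hu : (u : ZMod (2 ^ m)) = x := by rw [hu_def, ZMod.coe_unitOfCoprime, ZMod.natCast_zmod_val]
  have h := eisensteinDedekindTwo_apply_of_two_le N.divisors (stabCoeff N β) hT hm u
  rw [hu] at h
  rw [h, chiMinusFour_eq_ite, if_pos hx]
  push_cast
  rw [one_mul]
  refine Finset.sum_congr rfl fun t _ ↦ ?_
  rw [mul_comm (x.val : ℤ) (t : ℤ)]

/-- Unfolding of the Stevens smoothing at a class: `(Sm_5^5 μ)(a) = μ(a) − 5μ(a·5⁻¹) − 5μ(a·5) + 25μ(a)`.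
[cite: Stevens1982, §5.4 (PDF p. 73)] -/
theorem stevensSmoothing_five_apply (μ : (n : ℕ) → ZMod (2 ^ n) → ℚ_[2]) (m : ℕ) (a : ZMod (2 ^ m)) :
    stevensSmoothing 5 μ m a =
      μ m a - 5 * μ m (a * ((5 : ℕ) : ZMod (2 ^ m))⁻¹) - 5 * μ m (a * ((5 : ℕ) : ZMod (2 ^ m))) + 25 * μ m a := by
  simp only [stevensSmoothing_def, Pi.add_apply, Pi.sub_apply, Pi.smul_apply, smul_eq_mul, dilate_apply,
    codilate_apply]
  push_cast
  ring

/-- **The smoothed `C`-normalised measure vanishes off the `η = +1` classes of level `≥ 4`** (the shifts `a ↦ a·5^{±1}`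
preserve `a mod 4`). [cite: Stevens1982, §5.4 (PDF p. 73)] -/
theorem stevensSmoothing_eisNormMeasure_of_not (g : ℚ) {m : ℕ} (a : ZMod (2 ^ m)) (h : ¬ (4 ≤ m ∧ a.val % 4 = 1)) :
    stevensSmoothing 5 (eisNormMeasure N β g) m a = 0 := by
  rw [stevensSmoothing_five_apply]
  by_cases hm : 4 ≤ m
  · have ha : a.val % 4 ≠ 1 := fun ha ↦ h ⟨hm, ha⟩
    have h1 := (four_dvd_two_pow (by omega : 2 ≤ m)).trans (dvd_val_mul_five (by omega) a)
    have h2 := (four_dvd_two_pow (by omega : 2 ≤ m)).trans (dvd_val_mul_five_inv (by omega) a)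
    have hap : ¬ (4 ≤ m ∧ (a * ((5 : ℕ) : ZMod (2 ^ m))).val % 4 = 1) := fun hh ↦ by omega
    have ham : ¬ (4 ≤ m ∧ (a * ((5 : ℕ) : ZMod (2 ^ m))⁻¹).val % 4 = 1) := fun hh ↦ by omega
    rw [eisNormMeasure_of_not N β g h, eisNormMeasure_of_not N β g hap, eisNormMeasure_of_not N β g ham]
    ring
  · have hn : ∀ b : ZMod (2 ^ m), ¬ (4 ≤ m ∧ b.val % 4 = 1) := fun b hh ↦ hm hh.1
    rw [eisNormMeasure_of_not N β g (hn _), eisNormMeasure_of_not N β g (hn _), eisNormMeasure_of_not N β g (hn _)]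
    ring

/-- **The smoothed boundary term is an integer**: for `m ≥ 4`, `a.val ≡ 1 (4)`, with
`B(X) = N·(y_{X,m}/2^m − y_{X̄,m−1}/2^{m−1})`, the combination `B(A) − 5B(A·5⁻¹) − 5B(A·5) + 25B(A)` lies in `ℤ`
(`N y_X − 5 N y_{5X} ≡ X⁻¹ − X⁻¹ ≡ 0 (mod 2^m)`, any Bézout representatives). [folklore] -/
theorem exists_int_smoothed_boundary (hodd : Odd N) {m : ℕ} (hm : 4 ≤ m) (a : ZMod (2 ^ m)) (ha : a.val % 4 = 1) :
    ∃ z : ℤ, (fun X : ℕ ↦ (N : ℚ) * ((Int.gcdB ((2 ^ m : ℕ) : ℤ) (X * N) : ℚ) / (2 ^ m : ℕ) -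
        (Int.gcdB ((2 ^ (m - 1) : ℕ) : ℤ) (((X % 2 ^ (m - 1) : ℕ) : ℤ) * N) : ℚ) / (2 ^ (m - 1) : ℕ))) a.val -
      5 * (fun X : ℕ ↦ (N : ℚ) * ((Int.gcdB ((2 ^ m : ℕ) : ℤ) (X * N) : ℚ) / (2 ^ m : ℕ) -
        (Int.gcdB ((2 ^ (m - 1) : ℕ) : ℤ) (((X % 2 ^ (m - 1) : ℕ) : ℤ) * N) : ℚ) / (2 ^ (m - 1) : ℕ)))
          (a * ((5 : ℕ) : ZMod (2 ^ m))⁻¹).val -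
      5 * (fun X : ℕ ↦ (N : ℚ) * ((Int.gcdB ((2 ^ m : ℕ) : ℤ) (X * N) : ℚ) / (2 ^ m : ℕ) -
        (Int.gcdB ((2 ^ (m - 1) : ℕ) : ℤ) (((X % 2 ^ (m - 1) : ℕ) : ℤ) * N) : ℚ) / (2 ^ (m - 1) : ℕ)))
          (a * ((5 : ℕ) : ZMod (2 ^ m))).val +
      25 * (fun X : ℕ ↦ (N : ℚ) * ((Int.gcdB ((2 ^ m : ℕ) : ℤ) (X * N) : ℚ) / (2 ^ m : ℕ) -
        (Int.gcdB ((2 ^ (m - 1) : ℕ) : ℤ) (((X % 2 ^ (m - 1) : ℕ) : ℤ) * N) : ℚ) / (2 ^ (m - 1) : ℕ))) a.val = z := by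
  simp only []
  -- names
  set A := a.val with hA
  set Ap := (a * ((5 : ℕ) : ZMod (2 ^ m))).val with hAp
  set Am := (a * ((5 : ℕ) : ZMod (2 ^ m))⁻¹).val with hAm
  obtain ⟨hp4, hm4⟩ := val_shift_mod_four (by omega : 3 ≤ m) a ha
  have hAo : Odd (A : ℤ) := by exact_mod_cast odd_val_of_mod_four a ha
  have hApo : Odd (Ap : ℤ) := by exact_mod_cast odd_val_of_mod_four _ hp4
  have hAmo : Odd (Am : ℤ) := by exact_mod_cast odd_val_of_mod_four _ hm4
  have hbar : ∀ {X : ℕ}, Odd (X : ℤ) → Odd (((X % 2 ^ (m - 1) : ℕ) : ℤ)) := fun {X} hX ↦ by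
    have hX' : Odd X := by exact_mod_cast hX
    exact_mod_cast odd_mod_two_pow hX' (by omega)
  -- the shift congruences at level `m`
  have hc1 : ((2 ^ m : ℕ) : ℤ) ∣ (Ap : ℤ) - 5 * A := dvd_val_mul_five (by omega) a
  have hc2 : ((2 ^ m : ℕ) : ℤ) ∣ (A : ℤ) - 5 * Am := dvd_val_mul_five_inv (by omega) a
  -- and at level `m − 1`
  have hdvd' : ((2 ^ (m - 1) : ℕ) : ℤ) ∣ ((2 ^ m : ℕ) : ℤ) := by
    exact_mod_cast (pow_dvd_pow 2 (by omega : m - 1 ≤ m))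
  have hmod : ∀ X : ℕ, ((2 ^ (m - 1) : ℕ) : ℤ) ∣ (X : ℤ) - ((X % 2 ^ (m - 1) : ℕ) : ℤ) := fun X ↦
    (Nat.mod_modEq X (2 ^ (m - 1))).dvd
  have hc1' : ((2 ^ (m - 1) : ℕ) : ℤ) ∣ ((Ap % 2 ^ (m - 1) : ℕ) : ℤ) - 5 * ((A % 2 ^ (m - 1) : ℕ) : ℤ) := by
    have h := (hdvd'.trans hc1)
    have e : ((Ap % 2 ^ (m - 1) : ℕ) : ℤ) - 5 * ((A % 2 ^ (m - 1) : ℕ) : ℤ) =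
        ((Ap : ℤ) - 5 * A) - ((Ap : ℤ) - ((Ap % 2 ^ (m - 1) : ℕ) : ℤ)) + 5 * ((A : ℤ) - ((A % 2 ^ (m - 1) : ℕ) : ℤ)) := by
      ring
    rw [e]
    exact dvd_add (dvd_sub h (hmod Ap)) (dvd_mul_of_dvd_right (hmod A) _)
  have hc2' : ((2 ^ (m - 1) : ℕ) : ℤ) ∣ ((A % 2 ^ (m - 1) : ℕ) : ℤ) - 5 * ((Am % 2 ^ (m - 1) : ℕ) : ℤ) := by
    have h := (hdvd'.trans hc2)
    have e : ((A % 2 ^ (m - 1) : ℕ) : ℤ) - 5 * ((Am % 2 ^ (m - 1) : ℕ) : ℤ) =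
        ((A : ℤ) - 5 * Am) - ((A : ℤ) - ((A % 2 ^ (m - 1) : ℕ) : ℤ)) + 5 * ((Am : ℤ) - ((Am % 2 ^ (m - 1) : ℕ) : ℤ)) := by
      ring
    rw [e]
    exact dvd_add (dvd_sub h (hmod A)) (dvd_mul_of_dvd_right (hmod Am) _)
  -- the four divisibilities
  obtain ⟨q₁, hq₁⟩ := two_pow_dvd_bezout_shift hodd m hAo hApo 5 hc1
  obtain ⟨q₂, hq₂⟩ := two_pow_dvd_bezout_shift hodd (m - 1) (hbar hAo) (hbar hApo) 5 hc1'
  obtain ⟨q₃, hq₃⟩ := two_pow_dvd_bezout_shift hodd m hAmo hAo 5 hc2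
  obtain ⟨q₄, hq₄⟩ := two_pow_dvd_bezout_shift hodd (m - 1) (hbar hAmo) (hbar hAo) 5 hc2'
  refine ⟨q₁ - q₂ - 5 * (q₃ - q₄), ?_⟩
  have h2m : ((2 ^ m : ℕ) : ℚ) ≠ 0 := by positivity
  have h2m' : ((2 ^ (m - 1) : ℕ) : ℚ) ≠ 0 := by positivity
  have hq₁' : (N : ℚ) * ((Int.gcdB ((2 ^ m : ℕ) : ℤ) (A * N) : ℚ) - 5 * (Int.gcdB ((2 ^ m : ℕ) : ℤ) (Ap * N) : ℚ)) =
      ((2 ^ m : ℕ) : ℚ) * q₁ := by exact_mod_cast hq₁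
  have hq₂' : (N : ℚ) * ((Int.gcdB ((2 ^ (m - 1) : ℕ) : ℤ) (((A % 2 ^ (m - 1) : ℕ) : ℤ) * N) : ℚ) -
      5 * (Int.gcdB ((2 ^ (m - 1) : ℕ) : ℤ) (((Ap % 2 ^ (m - 1) : ℕ) : ℤ) * N) : ℚ)) = ((2 ^ (m - 1) : ℕ) : ℚ) * q₂ := by
    exact_mod_cast hq₂
  have hq₃' : (N : ℚ) * ((Int.gcdB ((2 ^ m : ℕ) : ℤ) (Am * N) : ℚ) - 5 * (Int.gcdB ((2 ^ m : ℕ) : ℤ) (A * N) : ℚ)) =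
      ((2 ^ m : ℕ) : ℚ) * q₃ := by exact_mod_cast hq₃
  have hq₄' : (N : ℚ) * ((Int.gcdB ((2 ^ (m - 1) : ℕ) : ℤ) (((Am % 2 ^ (m - 1) : ℕ) : ℤ) * N) : ℚ) -
      5 * (Int.gcdB ((2 ^ (m - 1) : ℕ) : ℤ) (((A % 2 ^ (m - 1) : ℕ) : ℤ) * N) : ℚ)) = ((2 ^ (m - 1) : ℕ) : ℚ) * q₄ := by
    exact_mod_cast hq₄
  -- abbreviate the Bézout coefficients (as rationals)
  set D : ℚ := ((2 ^ m : ℕ) : ℚ) with hD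
  set D' : ℚ := ((2 ^ (m - 1) : ℕ) : ℚ) with hD'
  set yA : ℚ := (Int.gcdB ((2 ^ m : ℕ) : ℤ) (A * N) : ℚ)
  set yAp : ℚ := (Int.gcdB ((2 ^ m : ℕ) : ℤ) (Ap * N) : ℚ)
  set yAm : ℚ := (Int.gcdB ((2 ^ m : ℕ) : ℤ) (Am * N) : ℚ)
  set zA : ℚ := (Int.gcdB ((2 ^ (m - 1) : ℕ) : ℤ) (((A % 2 ^ (m - 1) : ℕ) : ℤ) * N) : ℚ)
  set zAp : ℚ := (Int.gcdB ((2 ^ (m - 1) : ℕ) : ℤ) (((Ap % 2 ^ (m - 1) : ℕ) : ℤ) * N) : ℚ)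
  set zAm : ℚ := (Int.gcdB ((2 ^ (m - 1) : ℕ) : ℤ) (((Am % 2 ^ (m - 1) : ℕ) : ℤ) * N) : ℚ)
  have e1 : (N : ℚ) * (yA / D - zA / D') - 5 * ((N : ℚ) * (yAp / D - zAp / D')) = (q₁ : ℚ) - q₂ := by
    rw [show (N : ℚ) * (yA / D - zA / D') - 5 * ((N : ℚ) * (yAp / D - zAp / D')) =
      ((N : ℚ) * (yA - 5 * yAp)) / D - ((N : ℚ) * (zA - 5 * zAp)) / D' by ring, hq₁', hq₂',
      mul_div_cancel_left₀ _ h2m, mul_div_cancel_left₀ _ h2m']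
  have e2 : (N : ℚ) * (yAm / D - zAm / D') - 5 * ((N : ℚ) * (yA / D - zA / D')) = (q₃ : ℚ) - q₄ := by
    rw [show (N : ℚ) * (yAm / D - zAm / D') - 5 * ((N : ℚ) * (yA / D - zA / D')) =
      ((N : ℚ) * (yAm - 5 * yA)) / D - ((N : ℚ) * (zAm - 5 * zA)) / D' by ring, hq₃', hq₄',
      mul_div_cancel_left₀ _ h2m, mul_div_cancel_left₀ _ h2m']
  rw [show ((q₁ - q₂ - 5 * (q₃ - q₄) : ℤ) : ℚ) = (q₁ : ℚ) - q₂ - 5 * ((q₃ : ℚ) - q₄) by push_cast; ring]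
  linear_combination e1 - 5 * e2

/-- **THE POINTWISE ESTIMATE.** On an `η = +1` class `a` of level `m ≥ 4`, the Stevens smoothing of the `C`-normalised Eisenstein
measure in the `8`-normalisation is `−(3/2)·Sm_5^5 E_{N.divisors,c}(a)` up to `2ℤ₂`:
`‖(Sm_5^5 ν₈)(a) + (3/2)·(Sm_5^5 E)(a)‖₂ ≤ 2⁻¹`. Mechanism: `8ν₈ = [−12E + c_β·B](X) − [level constant]` pointwise
(`stabEisensteinPeriod_sub_level`); `Sm` of the constant is `16 ×` a `2`-adic integer; `Sm` of the Bézout boundary term `B` is an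
INTEGER (`exists_int_smoothed_boundary`) and `‖c_β‖₂ ≤ 2⁻⁴`; `Sm E = smoothedEisensteinDedekindTwo` (lit).
[cite: Stevens1982, §5.4 Prop. 5.4.1 (PDF p. 73)] [cite: MazurTateTeitelbaum1986Invent, §I.10–I.11] -/
theorem norm_stevensSmoothing_eisNormMeasure_add_le (hodd : Odd N) (hadm : IsAdmissibleStabData N β) {m : ℕ}
    (hm : 4 ≤ m) (a : ZMod (2 ^ m)) (ha : a.val % 4 = 1) :
    ‖stevensSmoothing 5 (eisNormMeasure N β 8) m a +
        (3 / 2 : ℚ_[2]) * smoothedEisensteinDedekindTwo N.divisors (stabCoeff N β) m a‖ ≤ 2⁻¹ := by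
  have hN : N ≠ 0 := fun h ↦ by simp [h] at hodd
  obtain ⟨hp4, hm4⟩ := val_shift_mod_four (by omega : 3 ≤ m) a ha
  -- the smoothed boundary term is an integer (obtain it before introducing abbreviations)
  obtain ⟨z, hz⟩ := exists_int_smoothed_boundary hodd hm a ha
  simp only [] at hz
  -- abbreviations
  set cβ : ℚ := ∑ t ∈ N.divisors, stabCoeff N β t / t with hcβ
  set E : ℕ → ℚ := fun X ↦ ∑ t ∈ N.divisors, stabCoeff N β t *
    (dedekindSum (t * X : ℤ) (2 ^ m) - dedekindSum (t * X : ℤ) (2 ^ (m - 1))) with hE_def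
  set B : ℕ → ℚ := fun X ↦ (N : ℚ) * ((Int.gcdB ((2 ^ m : ℕ) : ℤ) (X * N) : ℚ) / (2 ^ m : ℕ) -
    (Int.gcdB ((2 ^ (m - 1) : ℕ) : ℤ) (((X % 2 ^ (m - 1) : ℕ) : ℤ) * N) : ℚ) / (2 ^ (m - 1) : ℕ)) with hB_def
  set Φ : ℕ → ℚ := fun X ↦
    stabEisensteinPeriod N β (gammaEntries N X ((2 ^ m : ℕ) : ℤ)).1 (gammaEntries N X ((2 ^ m : ℕ) : ℤ)).2.1
        (gammaEntries N X ((2 ^ m : ℕ) : ℤ)).2.2.1 (gammaEntries N X ((2 ^ m : ℕ) : ℤ)).2.2.2 -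
      stabEisensteinPeriod N β (gammaEntries N ((X % 2 ^ (m - 1) : ℕ) : ℤ) ((2 ^ (m - 1) : ℕ) : ℤ)).1
        (gammaEntries N ((X % 2 ^ (m - 1) : ℕ) : ℤ) ((2 ^ (m - 1) : ℕ) : ℤ)).2.1
        (gammaEntries N ((X % 2 ^ (m - 1) : ℕ) : ℤ) ((2 ^ (m - 1) : ℕ) : ℤ)).2.2.1
        (gammaEntries N ((X % 2 ^ (m - 1) : ℕ) : ℤ) ((2 ^ (m - 1) : ℕ) : ℤ)).2.2.2 with hΦ_def
  have hz' : B a.val - 5 * B (a * ((5 : ℕ) : ZMod (2 ^ m))⁻¹).val - 5 * B (a * ((5 : ℕ) : ZMod (2 ^ m))).val +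
      25 * B a.val = z := hz
  -- closed form of `Φ` on odd arguments
  have hΦ : ∀ X : ℕ, Odd X → Φ X = -12 * E X + cβ * B X := fun X hX ↦ by
    simp only [hΦ_def, hE_def, hB_def, hcβ]
    exact stabEisensteinPeriod_sub_level hodd hadm (by omega) hX
  -- the measure on the three classes
  have hν : ∀ x : ZMod (2 ^ m), x.val % 4 = 1 →
      eisNormMeasure N β 8 m x = (((Φ x.val - Φ 1) / 8 : ℚ) : ℚ_[2]) := fun x hx ↦ by
    rw [eisNormMeasure_eq_sub_sub 8 hm x hx]
  -- lit's Eisenstein–Dedekind distribution on the three classes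
  have hE : ∀ x : ZMod (2 ^ m), x.val % 4 = 1 →
      eisensteinDedekindTwo N.divisors (stabCoeff N β) m x = ((E x.val : ℚ) : ℚ_[2]) := fun x hx ↦ by
    rw [eisensteinDedekindTwo_apply_of_mod_four hodd (by omega) x hx]
  have hsm : smoothedEisensteinDedekindTwo N.divisors (stabCoeff N β) m a =
      eisensteinDedekindTwo N.divisors (stabCoeff N β) m a -
        5 * eisensteinDedekindTwo N.divisors (stabCoeff N β) m (a * ((5 : ℕ) : ZMod (2 ^ m))⁻¹) -
        5 * eisensteinDedekindTwo N.divisors (stabCoeff N β) m (a * ((5 : ℕ) : ZMod (2 ^ m))) +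
        25 * eisensteinDedekindTwo N.divisors (stabCoeff N β) m a := by
    rw [← stevensSmoothing_eisensteinDedekindTwo]
    exact stevensSmoothing_five_apply _ m a
  -- the exact identity in `ℚ`
  have hA : Odd a.val := odd_val_of_mod_four a ha
  have hAp : Odd (a * ((5 : ℕ) : ZMod (2 ^ m))).val := odd_val_of_mod_four _ hp4
  have hAm : Odd (a * ((5 : ℕ) : ZMod (2 ^ m))⁻¹).val := odd_val_of_mod_four _ hm4
  have hq : ((Φ a.val - Φ 1) - 5 * (Φ (a * ((5 : ℕ) : ZMod (2 ^ m))⁻¹).val - Φ 1) -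
        5 * (Φ (a * ((5 : ℕ) : ZMod (2 ^ m))).val - Φ 1) + 25 * (Φ a.val - Φ 1)) / 8 +
      (3 / 2) * (E a.val - 5 * E (a * ((5 : ℕ) : ZMod (2 ^ m))⁻¹).val - 5 * E (a * ((5 : ℕ) : ZMod (2 ^ m))).val +
        25 * E a.val) = cβ * z / 8 - 2 * Φ 1 := by
    rw [hΦ _ hA, hΦ _ hAp, hΦ _ hAm, ← hz']
    ring
  have hcast : stevensSmoothing 5 (eisNormMeasure N β 8) m a +
      (3 / 2 : ℚ_[2]) * smoothedEisensteinDedekindTwo N.divisors (stabCoeff N β) m a =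
      ((cβ * z / 8 - 2 * Φ 1 : ℚ) : ℚ_[2]) := by
    rw [← hq, stevensSmoothing_five_apply, hν a ha, hν _ hm4, hν _ hp4, hsm, hE a ha, hE _ hm4, hE _ hp4]
    push_cast
    ring
  rw [hcast]
  -- sizes: `‖cβ‖ ≤ 2⁻⁴`, `z ∈ ℤ`, `‖Φ 1‖ ≤ 1`
  have hcβn : ‖((cβ : ℚ) : ℚ_[2])‖ ≤ (2 : ℝ) ^ (-(4 : ℤ)) := norm_cBeta_le hN hodd hadm
  have h1 : (1 : ℕ) % 2 ^ (m - 1) = 1 := Nat.one_mod_eq_one.mpr (by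
    have : 2 ≤ 2 ^ (m - 1) := by
      calc (2 : ℕ) = 2 ^ 1 := by norm_num
        _ ≤ 2 ^ (m - 1) := Nat.pow_le_pow_right (by norm_num) (by omega)
    omega)
  have hΦ1 : ‖((Φ 1 : ℚ) : ℚ_[2])‖ ≤ 1 := by
    simp only [hΦ_def, h1, Nat.cast_one, Rat.cast_sub]
    rw [sub_eq_add_neg]
    refine (Padic.nonarchimedean _ _).trans (max_le ?_ ?_)
    · exact_mod_cast norm_stabEisensteinPeriod_gammaEntries_le_one hodd β m odd_one
    · rw [norm_neg]
      exact_mod_cast norm_stabEisensteinPeriod_gammaEntries_le_one hodd β (m - 1) odd_one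
  have h8 : ‖(8 : ℚ_[2])‖ = (2 : ℝ) ^ (-(3 : ℤ)) := by
    rw [show (8 : ℚ_[2]) = ((2 : ℕ) : ℚ_[2]) ^ 3 by norm_num, Padic.norm_p_pow]; norm_num
  have h2 : ‖(2 : ℚ_[2])‖ = (2 : ℝ)⁻¹ := by exact_mod_cast Padic.norm_p (p := 2)
  push_cast
  rw [sub_eq_add_neg]
  refine (Padic.nonarchimedean _ _).trans (max_le ?_ ?_)
  · rw [norm_div, norm_mul, h8]
    calc ‖((cβ : ℚ) : ℚ_[2])‖ * ‖(z : ℚ_[2])‖ / (2 : ℝ) ^ (-(3 : ℤ))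
        ≤ (2 : ℝ) ^ (-(4 : ℤ)) * 1 / (2 : ℝ) ^ (-(3 : ℤ)) := by
          gcongr
          exact_mod_cast Padic.norm_int_le_one (p := 2) z
      _ = 2⁻¹ := by norm_num
  · rw [norm_neg, norm_mul, h2]
    calc (2 : ℝ)⁻¹ * ‖((Φ 1 : ℚ) : ℚ_[2])‖ ≤ 2⁻¹ * 1 := by gcongr
      _ = 2⁻¹ := mul_one _

end Smoothing

end Summit.BirchSwinnertonDyer.BirchSwinnertonDyer.Theorems.DepletionAtTwo

end
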